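import Summits.QuantumFields.YangMills.Theorems.BalabanUVNodesN16OfSocketsAllTorusPinned
import Literature.MathematicalPhysics.QuantumFieldTheory.Balaban1983to89.B8LeafKnitZd3FourPrinted
import Literature.MathematicalPhysics.QuantumFieldTheory.Balaban1983to89.B9SupplySockB9P3ZdAtFamilies

/-!
# Route «BalabanUVNodes», cluster K4 «SpineRates» — node N16 = NE3: THE LEAF LETTERS OF ONE CARRIER AT THE PINNED ALL-TORUS MEMBERS (node N05's two conjuncts
# `B8.Thm4Body` ∕ `B8.Prop3Body` and dag-n16-c's window) FROM NODE N06's [Balaban1985BackgroundPropagators] THEOREM 3.3 BY NAME, dag-n06-b's MEMBER-LOCAL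
# DICTIONARY AND THE [4] THEOREM 3.1-TYPE LETTERS — stage-free, edition-free, per carrier `L ≥ 2`, any colour algebra `𝔸`, any exponent `β`, any length letter `len`

Cell `pub-ymgap`, seat `pub-ymgap-dag-n16-e` (R134 acceleration seat (a), strategy s2 = BY-NAME KNIT at the record; HUMAN RULING D-0062; chair R424 venue), generation 15,
module 40ᴬ (THEOREMS ONLY, 0 `def`, 0 `sorry`, standard axioms; dag-lead WANTED-D3, DEDUP-330 (8)).  `--kind proof --supports stmt-QuantumFields-20544 --as helper` (K3⁷
`SpineGivenEndpointR13SepCoPH`, plan rev 24∕25, dag-lead WORDS-143).  `bears_on: R4∕N16 · edges N06 → N05 → N16`.  Companion of module 40ᴮ `…N16OfThm33LettersAllTorusAtRecord13CoPH`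
(N16 at dag-n22-e's Stage-13 reading of record from these letters), and the upstream twin of module 38ᴴ §0 (`…N16OfSocketsAllTorusAtRecord13CoPH.leafLettersAT_of_sockets(HFP₄)Pinned`:
the same leaf letters from node N05's FIVE SOCKETS).

WHAT THIS FILE PROVES (kernel bookkeeping by name; no estimate).  Fix `L ≥ 2`, a C⋆-algebra `𝔸` (`Nontrivial`), `β`, `len : ℤ⁴ → ℝ`, and the PINNED all-torus proper
sub-index of n05-a's datum `B8LeafModelZd.ZdIdx 4 L` — `{i // (∀ j, i.Ω j = univ) ∧ (∀ m j, i.Λs m j = {j = m}) ∧ (∀ m j, i.Λb m j = {j = m}) ∧ i.η = (L⁻¹)^{i.k}}` (dag-n16-c F47's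
literal; every member obeys node N05's four index laws, F47 `idxB8LawsB_allTorusPinned` = n05-c `B8IdxB8LawsB.idxB8LawsB_of_member_univ`; `1 ≤ i.k` is a LAW of `ZdIdx` (field `hk`), so
the sub-index has no depth-0 member and no separate depth-0 word is needed).
* §1 `sockB9P3_allLevels_allTorusPinned_of_thm33` — node N06's `h33 : B9.Thm33Printed c35 geo bg Gp GA` ([Balaban1985BackgroundPropagators] Thm 3.3 p. 399 as typed by the N06
  lineage, for an abstract frame `geo ∕ bg ∕ GA`) + dag-n06-b's member-local At-binders at the pinned members (`DictAt` — the abstract kernel family `GA` at `mem M i m` IS the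
  concrete operator letter `ops M i m` on `ℤ⁴`, norms identified; `Prop6At` — [Balaban1985RegularSpaces] Prop. 6 (1.136) in [4]'s dress (3.35); `InvAt` (3.27), `CurvAt` (3.69),
  `LandauAt` (3.20)–(3.21), `AvgAt` (3.16), `HolderAt` (3.43)∕(3.47) at `β, len`) ⟹ constants `B₀ ≥ 1`, `B₀β > 0`, `cP > 0` with Proposition 3's b9 socket
  `SockB9P3 L B₀ B₀β cP β len i.η m i.Ω i.Λs i.Λb` at EVERY pinned member and EVERY truncation `m ≤ i.k` — dag-n06-b `B9SupplySockB9P3ZdAtFamilies.sockB9P3_allLevels_of_thm33_univ_on`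
  at `ι := Subtype.val` (the pin gives `i.Ω 0 = univ`), then n05-a `B8LeafSocketsB9.sockB9P3_mono` to raise `(B₀, B₀β) ↦ (max 1 B₀, B₀β + 1)`.
* §2 ★ `leafLettersAT_of_thm33_letters` — §1's inputs + the [4] Theorem 3.1-type letters at the pinned members (n05-d's existence letters `B8SockLettersRD.SockLettersRD L BG BR B₀'H
  B₂' cL …` and n04-b∕n05-d's guarded uniqueness letters, the `SLetUB` block of `B8LeafKnitZd3FourPrinted.fourPrinted_zd3_map_lettersRDUB` VERBATIM) ⟹ THE BODY OF MODULE 37ᴴ's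
  PER-FAMILY HYPOTHESIS `h5`: `∃ c₁ c₁' B₁' cP' C₂ B₀β inp, 0 < B₁' ∧ 5·4·L·inp.B₀ ≤ B₁' ∧ 0 < c₁' ∧ (window) ∧ B8.Thm4Body c₁ B₁' (pinned fam).toGFData ∧ B8.Prop3Body cP' 4 L C₂
  inp B₀β (pinned fam).toGFData2` — proof = §1 ∘ n05-d `fourPrinted_zd3_map_lettersRDUB` ([Balaban1985RegularSpaces] Lemma 1, Thm 2, Prop. 3, Thm 4 AS PRINTED over an index map
  from the letters and the b9 socket; the two member laws it reads come from F47 `idxB8LawsB_allTorusPinned`) ∘ dag-n16-c `N16.OfLeaf.exists_window_print`, BY NAME.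

WHY (HOME `HANDOFF.md` §g14 «door considered, not typed» → §g15 D3; dag-lead DEDUP-330 (8) WANTED).  Module 38ᴴ displays node N05's FIVE SOCKETS at the pinned members as
hypotheses; the sockets are themselves consequences of [4]'s Theorems 3.1∕3.3 and the dictionaries — the interface node N06's seats serve (`B9SupplySockB9P3ZdAt*`).  After this
file and 40ᴮ the N16 slot of the K3⁷ reading displays, upstream of N07's `LeafH3sup`, only: node N06's Theorem 3.3 as typed, the member-local dictionary∕letters, and
Proposition 6 in [4]'s dress — the N16 analogue of dag-n05-d's `BalabanUVNodesN05SubBHKnitUnivOfThm33(Lin)` (θ-keyed `Ω₀ = ℤᵈ` road), here θ-free at the pinned members.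
Neither certified vacuity bites here: `B8JunctionH59Vacuity` refutes GLOBAL binders over ALL members (incl. the finite-`Ω₀` cube member), `B8SockH59NotAtUnivDegenerate`
refutes sockets at univ members with EMPTY truncation data — the pinned proper members are neither (their header names this sub-index as the sound key).  Joint
satisfiability of the At-binders at the pinned members is node N05's ∕ N06's content (witnessed at truncation 0 only: dag-n06-b `sockB9P3_at_univ_nonvacuous_zero`).

HONEST FRAMING.  Kernel bookkeeping by name; no estimate; [Balaban1985BackgroundPropagators] Thm 3.3 (`h33`), the dictionaries, Prop. 6 in [4]'s dress and the [4]
Thm 3.1-type letters are HYPOTHESES asserted for no family — node N05's ∕ N06's open obligations; nothing of Bałaban's analysis is asserted; **N16 ∕ NE3 is NOT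
discharged**; count-neutral (typed 28∕28 · discharged 5∕27, A 5∕28 UNMOVED); one finite four-torus at fixed ε — NOT ℝ⁴, NOT infinite volume, NOT OS, NOT a mass gap,
NOT Clay.  No `sorry`, no `def`, no `instance`, no `notation`.
-/

set_option autoImplicit false

open NormedSpace

namespace Summit.QuantumFields.YangMills.BalabanUVNodes.N16LeafLettersAllTorusOfThm33

open Literature.MathematicalPhysics.QuantumFieldTheory.Balaban1983to89
open B7Prop1Explicit B7Prop2Explicit
open B7Prop3Flat (c3)
open B8Ineq132 (InAk covDerivFwd)
open B8LeafModelZd (ZdIdx)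
open B8LeafModelZd3 (zdGF3 SockB9P3)
open B8SockLettersRD (SockLettersRD)
open B7Eq78Linearization (zdBlocking QprimeIter)
open B8Eq119TwistedAxial (bgT)
open B8Eq140Level (SideTouches)
open B8Eq138LandauZd (covLap QT)
open B8Eq1117Concrete (XSpace)
open B8Prop5ContractionKLevel (Bd2)
open B8LambdaSpaceKLevel (wt)
open B9SupplySockB9P3ZdLetters (OpsZd)
open B9SupplySockB9P3ZdAt (DictAt Prop6At InvAt CurvAt LandauAt AvgAt HolderAt)
open B9SupplySockB9P3ZdAtFamilies (sockB9P3_allLevels_of_thm33_univ_on)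
open B8LeafSocketsB9 (sockB9P3_mono)
open B8LeafKnitZd3FourPrinted (fourPrinted_zd3_map_lettersRDUB)
open Summit.QuantumFields.YangMills.BalabanUVNodes.N16OfSocketsAllTorusPinned (idxB8LawsB_allTorusPinned)
open Summit.QuantumFields.YangMills.BalabanUVNodes.N16.OfLeaf (exists_window_print)

noncomputable section

variable {𝔸 : Type} [CStarAlgebra 𝔸] [Nontrivial 𝔸]

/-! ## §1 Proposition 3's b9 socket at every pinned all-torus member and every truncation, from node N06's Theorem 3.3 and the member-local dictionary -/

/-- **PROPOSITION 3's b9 SOCKET AT EVERY PINNED ALL-TORUS MEMBER AND EVERY TRUNCATION `m ≤ k`, FROM NODE N06's [4] THEOREM 3.3 BY NAME** (`d = 4`, `L ≥ 2`, any `β`,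
`len`): `h33 : B9.Thm33Printed c35 geo bg Gp GA` for an abstract [B9] frame, dag-n06-b's member-local At-binders at the pinned members (`DictAt`, `Prop6At`, `InvAt`, `CurvAt`,
`LandauAt`, `AvgAt`, `HolderAt` at `β, len`, with Proposition 6's threshold parameter `M₃` and the letters' constants `c₆ K₆ a₃ > 0`, `c69 q ≥ 0`, `CH`) give `B₀ ≥ 1`,
`B₀β > 0`, `cP > 0` with `SockB9P3 L B₀ B₀β cP β len i.η m i.Ω i.Λs i.Λb` for every pinned `i` and every `m ≤ i.k` — dag-n06-b
`B9SupplySockB9P3ZdAtFamilies.sockB9P3_allLevels_of_thm33_univ_on` at `ι := Subtype.val` (the pin supplies `i.Ω 0 = univ`), raised to `(max 1 B₀, B₀β + 1)` by n05-a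
`B8LeafSocketsB9.sockB9P3_mono`.  Theorem 3.3 and the binders are HYPOTHESES; nothing of [4] is proved here.
[cite: Balaban1985BackgroundPropagators, Thm 3.3 p.399, (3.27) p.395, (3.69) p.404; Balaban1985RegularSpaces, (1.58)–(1.59) p.86, Prop. 3 p.87, p.77] [folklore] -/
theorem sockB9P3_allLevels_allTorusPinned_of_thm33 {L : ℕ} (hL : 2 ≤ L) (β : ℝ) (len : Site 4 → ℝ)
    {I : Type} (geo : I → B9.Geometry) (bg : I → B9.Backgrounds) (GA : ∀ i, B9.KernelFamily (geo i) (bg i))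
    {Gp : ∀ i, B9.KernelFamily (geo i) (bg i)} {c35 : ℝ} (h33 : B9.Thm33Printed c35 geo bg Gp GA)
    (mem : ℝ → ZdIdx 4 L → ℕ → I)
    (ιCfg : ∀ (M : ℝ) (i : ZdIdx 4 L) (m : ℕ) (U₀ : Site 4 → Fin 4 → 𝔸ˣ), (∀ x κ, U₀ x κ ∈ unitaryUnits 𝔸) → (bg (mem M i m)).Cfg)
    (ιLoc : ∀ (M : ℝ) (i : ZdIdx 4 L) (m : ℕ), (Site 4 → Fin 4 → 𝔸) → (geo (mem M i m)).Loc)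
    (ops : ℝ → ZdIdx 4 L → ℕ → OpsZd 4 𝔸) {c₆ K₆ M₃ a₃ c69 q CH : ℝ}
    (hdict : ∀ (M : ℝ) (i : {i : ZdIdx 4 L // (∀ j, i.Ω j = Set.univ) ∧ (∀ m j, i.Λs m j = {_y | j = m}) ∧ (∀ m j, i.Λb m j = {_c | j = m}) ∧ i.η = ((L : ℝ)⁻¹) ^ i.k}) (m : ℕ),
      DictAt geo bg GA L mem ιCfg ιLoc ops M i.1 m)
    (hP6 : ∀ (M : ℝ) (i : {i : ZdIdx 4 L // (∀ j, i.Ω j = Set.univ) ∧ (∀ m j, i.Λs m j = {_y | j = m}) ∧ (∀ m j, i.Λb m j = {_c | j = m}) ∧ i.η = ((L : ℝ)⁻¹) ^ i.k}) (m : ℕ),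
      M₃ ≤ M → Prop6At bg L mem ιCfg c35 c₆ K₆ M i.1 m)
    (hinv : ∀ (M : ℝ) (i : {i : ZdIdx 4 L // (∀ j, i.Ω j = Set.univ) ∧ (∀ m j, i.Λs m j = {_y | j = m}) ∧ (∀ m j, i.Λb m j = {_c | j = m}) ∧ i.η = ((L : ℝ)⁻¹) ^ i.k}) (m : ℕ),
      M₃ ≤ M → InvAt bg L mem ιCfg ops c35 a₃ M i.1 m)
    (hcurv : ∀ (M : ℝ) (i : {i : ZdIdx 4 L // (∀ j, i.Ω j = Set.univ) ∧ (∀ m j, i.Λs m j = {_y | j = m}) ∧ (∀ m j, i.Λb m j = {_c | j = m}) ∧ i.η = ((L : ℝ)⁻¹) ^ i.k}) (m : ℕ),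
      M₃ ≤ M → CurvAt bg L mem ιCfg ops c35 a₃ c69 M i.1 m)
    (hlan : ∀ (M : ℝ) (i : {i : ZdIdx 4 L // (∀ j, i.Ω j = Set.univ) ∧ (∀ m j, i.Λs m j = {_y | j = m}) ∧ (∀ m j, i.Λb m j = {_c | j = m}) ∧ i.η = ((L : ℝ)⁻¹) ^ i.k}) (m : ℕ),
      M₃ ≤ M → LandauAt bg L mem ιCfg ops c35 a₃ M i.1 m)
    (havg : ∀ (M : ℝ) (i : {i : ZdIdx 4 L // (∀ j, i.Ω j = Set.univ) ∧ (∀ m j, i.Λs m j = {_y | j = m}) ∧ (∀ m j, i.Λb m j = {_c | j = m}) ∧ i.η = ((L : ℝ)⁻¹) ^ i.k}) (m : ℕ),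
      AvgAt L ops q M i.1 m)
    (hhol : ∀ (M : ℝ) (i : {i : ZdIdx 4 L // (∀ j, i.Ω j = Set.univ) ∧ (∀ m j, i.Λs m j = {_y | j = m}) ∧ (∀ m j, i.Λb m j = {_c | j = m}) ∧ i.η = ((L : ℝ)⁻¹) ^ i.k}) (m : ℕ),
      HolderAt geo bg GA L mem ιCfg ops β len CH M i.1 m)
    (hc₆ : 0 < c₆) (hK₆ : 0 < K₆) (ha₃ : 0 < a₃) (hc69 : 0 ≤ c69) (hq : 0 ≤ q) :
    ∃ B₀ B₀β cP : ℝ, 1 ≤ B₀ ∧ 0 < B₀β ∧ 0 < cP ∧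
      ∀ (i : {i : ZdIdx 4 L // (∀ j, i.Ω j = Set.univ) ∧ (∀ m j, i.Λs m j = {_y | j = m}) ∧ (∀ m j, i.Λb m j = {_c | j = m}) ∧ i.η = ((L : ℝ)⁻¹) ^ i.k}) (m : ℕ),
        m ≤ i.1.k → SockB9P3 (𝔸 := 𝔸) L B₀ B₀β cP β len i.1.η m i.1.Ω i.1.Λs i.1.Λb := by
  -- node N06's Theorem 3.3 opened ONCE by dag-n06-b's supplier over the index map `ι := Subtype.val` of the pinned members (`i.Ω 0 = univ` by the pin)
  obtain ⟨B₀, B₀β, cP, -, hB₀β, hcP, hS⟩ := sockB9P3_allLevels_of_thm33_univ_on geo bg GA L mem ιCfg ιLoc ops (by norm_num) (by omega) h33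
    (fun i : {i : ZdIdx 4 L // (∀ j, i.Ω j = Set.univ) ∧ (∀ m j, i.Λs m j = {_y | j = m}) ∧ (∀ m j, i.Λb m j = {_c | j = m}) ∧ i.η = ((L : ℝ)⁻¹) ^ i.k} => i.1)
    (fun i => i.2.1 0) hdict hP6 hinv hcurv hlan havg hhol hc₆ hK₆ ha₃ hc69 hq
  -- raise the two constants (the socket's right sides are monotone in `B₀`, `B₀β`: n05-a `sockB9P3_mono`)
  refine ⟨max 1 B₀, B₀β + 1, cP, le_max_left _ _, by linarith, hcP, fun i m hm => ?_⟩
  exact sockB9P3_mono (le_max_right _ _) (by linarith) i.1.hη.le (hS i m hm)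

/-! ## §2 The leaf letters of one carrier (module 37ᴴ's `h5` body) from Theorem 3.3, the dictionary and the [4] Theorem 3.1-type letters -/

/-- ★ **THE AT LEAF LETTERS OF ONE CARRIER FROM NODE N06's THEOREM 3.3, THE MEMBER-LOCAL DICTIONARY AND THE [4] THEOREM 3.1-TYPE LETTERS AT THE PINNED ALL-TORUS MEMBERS**
(`d = 4`, `L ≥ 2`, any `𝔸`, `β`, `len`): §1's inputs together with, at every pinned member, n05-d's existence letters `SockLettersRD L BG BR B₀'H B₂' cL …` ([4] Thms
3.1–3.3 for Bałaban's operators `G′, Δ, Q′, Q′ᵀ, 𝔄, C, H′` on print's domains, ONE hypothesis per member) and n04-b∕n05-d's guarded uniqueness letters (the twelve laws at the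
top structure, left-inverse law of `G′` on bounded functions only) give letters `c₁ c₁' B₁' cP' C₂ B₀β inp` with `0 < B₁'`, `5·4·L·inp.B₀ ≤ B₁'` (equality: `B₁' = 5dL·B₀`),
`0 < c₁'`, dag-n16-c's window below the printed thresholds, and node N05's two conjuncts `B8.Thm4Body c₁ B₁'` ∕ `B8.Prop3Body cP' 4 L C₂ inp B₀β` read on the pinned
sub-family of `zdGF3 𝔸 L β len` — the body of module 37ᴴ's per-family hypothesis `h5` (and of 38ᴴ §0's conclusion).  Proof: §1, then n05-d
`B8LeafKnitZd3FourPrinted.fourPrinted_zd3_map_lettersRDUB` ([Balaban1985RegularSpaces] Lemma 1, Thm 2, Prop. 3, Thm 4 AS PRINTED over an index map from the letters and the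
b9 socket — its two member laws №8 from F47 `idxB8LawsB_allTorusPinned`, its towers law trivial at `Ω ≡ univ`, its free-constant condition `3·(2dL²)·BG·BR ≤ inp.B₀'` met by
the choice `inp.B₀' := max 1 (3·(2dL²)·BG·BR)`), then dag-n16-c `N16.OfLeaf.exists_window_print`, BY NAME.  Theorem 3.3, the dictionary and the letters are HYPOTHESES;
nothing of [4] or of [Balaban1985RegularSpaces]'s analysis is proved here.
[cite: Balaban1985RegularSpaces, Lemma 1 p.79, Thm 2 p.83, Prop. 3 p.87, Thm 4 p.88, Prop. 5 (1.106)–(1.109) p.94, (1.59) p.86, p.77; Balaban1985BackgroundPropagators, Thm 3.1 p.397, Thm 3.3 p.399] [folklore] -/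
theorem leafLettersAT_of_thm33_letters {L : ℕ} (hL : 2 ≤ L) (β : ℝ) (len : Site 4 → ℝ)
    {I : Type} (geo : I → B9.Geometry) (bg : I → B9.Backgrounds) (GA : ∀ i, B9.KernelFamily (geo i) (bg i))
    {Gp : ∀ i, B9.KernelFamily (geo i) (bg i)} {c35 : ℝ} (h33 : B9.Thm33Printed c35 geo bg Gp GA)
    (mem : ℝ → ZdIdx 4 L → ℕ → I)
    (ιCfg : ∀ (M : ℝ) (i : ZdIdx 4 L) (m : ℕ) (U₀ : Site 4 → Fin 4 → 𝔸ˣ), (∀ x κ, U₀ x κ ∈ unitaryUnits 𝔸) → (bg (mem M i m)).Cfg)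
    (ιLoc : ∀ (M : ℝ) (i : ZdIdx 4 L) (m : ℕ), (Site 4 → Fin 4 → 𝔸) → (geo (mem M i m)).Loc)
    (ops : ℝ → ZdIdx 4 L → ℕ → OpsZd 4 𝔸) {c₆ K₆ M₃ a₃ c69 q CH : ℝ}
    (hdict : ∀ (M : ℝ) (i : {i : ZdIdx 4 L // (∀ j, i.Ω j = Set.univ) ∧ (∀ m j, i.Λs m j = {_y | j = m}) ∧ (∀ m j, i.Λb m j = {_c | j = m}) ∧ i.η = ((L : ℝ)⁻¹) ^ i.k}) (m : ℕ),
      DictAt geo bg GA L mem ιCfg ιLoc ops M i.1 m)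
    (hP6 : ∀ (M : ℝ) (i : {i : ZdIdx 4 L // (∀ j, i.Ω j = Set.univ) ∧ (∀ m j, i.Λs m j = {_y | j = m}) ∧ (∀ m j, i.Λb m j = {_c | j = m}) ∧ i.η = ((L : ℝ)⁻¹) ^ i.k}) (m : ℕ),
      M₃ ≤ M → Prop6At bg L mem ιCfg c35 c₆ K₆ M i.1 m)
    (hinv : ∀ (M : ℝ) (i : {i : ZdIdx 4 L // (∀ j, i.Ω j = Set.univ) ∧ (∀ m j, i.Λs m j = {_y | j = m}) ∧ (∀ m j, i.Λb m j = {_c | j = m}) ∧ i.η = ((L : ℝ)⁻¹) ^ i.k}) (m : ℕ),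
      M₃ ≤ M → InvAt bg L mem ιCfg ops c35 a₃ M i.1 m)
    (hcurv : ∀ (M : ℝ) (i : {i : ZdIdx 4 L // (∀ j, i.Ω j = Set.univ) ∧ (∀ m j, i.Λs m j = {_y | j = m}) ∧ (∀ m j, i.Λb m j = {_c | j = m}) ∧ i.η = ((L : ℝ)⁻¹) ^ i.k}) (m : ℕ),
      M₃ ≤ M → CurvAt bg L mem ιCfg ops c35 a₃ c69 M i.1 m)
    (hlan : ∀ (M : ℝ) (i : {i : ZdIdx 4 L // (∀ j, i.Ω j = Set.univ) ∧ (∀ m j, i.Λs m j = {_y | j = m}) ∧ (∀ m j, i.Λb m j = {_c | j = m}) ∧ i.η = ((L : ℝ)⁻¹) ^ i.k}) (m : ℕ),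
      M₃ ≤ M → LandauAt bg L mem ιCfg ops c35 a₃ M i.1 m)
    (havg : ∀ (M : ℝ) (i : {i : ZdIdx 4 L // (∀ j, i.Ω j = Set.univ) ∧ (∀ m j, i.Λs m j = {_y | j = m}) ∧ (∀ m j, i.Λb m j = {_c | j = m}) ∧ i.η = ((L : ℝ)⁻¹) ^ i.k}) (m : ℕ),
      AvgAt L ops q M i.1 m)
    (hhol : ∀ (M : ℝ) (i : {i : ZdIdx 4 L // (∀ j, i.Ω j = Set.univ) ∧ (∀ m j, i.Λs m j = {_y | j = m}) ∧ (∀ m j, i.Λb m j = {_c | j = m}) ∧ i.η = ((L : ℝ)⁻¹) ^ i.k}) (m : ℕ),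
      HolderAt geo bg GA L mem ιCfg ops β len CH M i.1 m)
    (hc₆ : 0 < c₆) (hK₆ : 0 < K₆) (ha₃ : 0 < a₃) (hc69 : 0 ≤ c69) (hq : 0 ≤ q)
    -- the [4] Theorem 3.1-type letters at the pinned members: existence side on print's domains, uniqueness side at the top structure
    {B₀'H B₂' BG BR cL : ℝ} (hB₀'H : 0 < B₀'H) (hB₂' : 0 ≤ B₂') (hBG : 0 ≤ BG) (hBR : 0 ≤ BR) (hcL : 0 < cL)
    (SLet : ∀ i : {i : ZdIdx 4 L // (∀ j, i.Ω j = Set.univ) ∧ (∀ m j, i.Λs m j = {_y | j = m}) ∧ (∀ m j, i.Λb m j = {_c | j = m}) ∧ i.η = ((L : ℝ)⁻¹) ^ i.k},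
      SockLettersRD (𝔸 := 𝔸) L BG BR B₀'H B₂' cL i.1.η i.1.k i.1.Ω i.1.Λs)
    (SLetUB : ∀ i : {i : ZdIdx 4 L // (∀ j, i.Ω j = Set.univ) ∧ (∀ m j, i.Λs m j = {_y | j = m}) ∧ (∀ m j, i.Λb m j = {_c | j = m}) ∧ i.η = ((L : ℝ)⁻¹) ^ i.k},
      ∀ α₀ : ℝ, 0 < α₀ → α₀ ≤ cL → ∀ U₀ : Site 4 → Fin 4 → 𝔸ˣ, (∀ x κ, U₀ x κ ∈ unitaryUnits 𝔸) →
      InAk L i.1.k i.1.η α₀ i.1.Ω U₀ →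
      ∃ (g Δ : (Site 4 → 𝔸) →ₗ[ℂ] (Site 4 → 𝔸)) (q : (Site 4 → 𝔸) →ₗ[ℂ] (ℕ → Site 4 → 𝔸)) (qs : (ℕ → Site 4 → 𝔸) →ₗ[ℂ] (Site 4 → 𝔸))
        (Aw c : (ℕ → Site 4 → 𝔸) →ₗ[ℂ] (ℕ → Site 4 → 𝔸)) (H' : XSpace 4 i.1.k 𝔸 →ₗ[ℂ] (Site 4 → 𝔸)),
        (∀ x : Site 4 → 𝔸, (∃ C : ℝ, ∀ y, ‖x y‖ ≤ C) → g (Δ x + qs (Aw (q x))) = x) ∧ (∀ φ, qs (c (q (g (g (qs φ))))) = qs φ) ∧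
        (∀ (f : Site 4 → 𝔸), ∀ x ∈ i.1.Ω 0, Δ f x = covLap i.1.η U₀ ((i.1.Ω 0).indicator f) x) ∧
        (∀ (μ : ℕ → Site 4 → 𝔸), ∀ x ∈ i.1.Ω 0, qs μ x = QT L i.1.k (i.1.Λs i.1.k) U₀ μ x) ∧
        (∀ (f : Site 4 → 𝔸) (n : ℕ), n ≤ i.1.k → ∀ y ∈ i.1.Λs i.1.k n, q f n y = QprimeIter (zdBlocking 4 L) (bgT L U₀) n f y) ∧
        (∀ (f : Site 4 → 𝔸) (n : ℕ) (y : Site 4), ¬ (n ≤ i.1.k ∧ y ∈ i.1.Λs i.1.k n) → q f n y = 0) ∧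
        (∀ (X : XSpace 4 i.1.k 𝔸) (x : Site 4), ‖H' X x‖ ≤ B₀'H * ‖X‖) ∧
        (∀ n, n ≤ i.1.k → ∀ (X : XSpace 4 i.1.k 𝔸), ∀ p ∈ {b : Site 4 × Fin 4 | SideTouches (i.1.Ω n) b.1 b.2},
          wt L i.1.η n * ‖covDerivFwd i.1.η U₀ p.2 (H' X) p.1‖ ≤ B₀'H * ‖X‖) ∧
        (∀ X : XSpace 4 i.1.k 𝔸, Bd2 L i.1.η i.1.k i.1.Ω (covLap i.1.η U₀ (H' X)) (B₂' * ‖X‖)) ∧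
        (∀ (Y : XSpace 4 i.1.k 𝔸) (n : ℕ) (hn : n ≤ i.1.k) (y : Site 4), y ∈ i.1.Λs i.1.k n →
          QprimeIter (zdBlocking 4 L) (bgT L U₀) n (H' Y) y = Y (⟨n, Nat.lt_succ_of_le hn⟩, y)) ∧
        (∀ (f : Site 4 → 𝔸) (r : ℝ), 0 ≤ r → Bd2 L i.1.η i.1.k i.1.Ω f r →
          (∀ x, ‖g f x‖ ≤ BG * r) ∧ ∀ n, n ≤ i.1.k → ∀ p ∈ {b : Site 4 × Fin 4 | SideTouches (i.1.Ω n) b.1 b.2},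
            wt L i.1.η n * ‖covDerivFwd i.1.η U₀ p.2 (g f) p.1‖ ≤ BG * r) ∧
        (∀ (f : Site 4 → 𝔸) (r : ℝ), 0 ≤ r → Bd2 L i.1.η i.1.k i.1.Ω f r → Bd2 L i.1.η i.1.k i.1.Ω (f - g (qs (c (q (g f))))) (BR * r))) :
    ∃ (c₁ c₁' B₁' cP' C₂ B₀β : ℝ) (inp : B8.B9Inputs), 0 < B₁' ∧ 5 * ((4 : ℕ) : ℝ) * L * inp.B₀ ≤ B₁' ∧ 0 < c₁' ∧
      (∀ α₀ α₁ : ℝ, 0 < α₀ → 0 < α₁ → α₀ + α₁ ≤ c₁' →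
        α₀ + α₁ ≤ c₁ ∧ C0 4 * (2 * α₀) ≤ 1 / 3 ∧ 4 * α₀ ≤ c2' 4 L ∧ 16 * (B₁' * (α₀ + α₁)) ≤ 1 ∧
        Real.exp (4 * (800 * (((4 : ℕ) : ℝ) + 1) ^ 2 * (((4 : ℕ) : ℝ) + 4)) * α₀) * (1 + 8 * (131072 * (((4 : ℕ) : ℝ) + 1) ^ 2) * (B₁' * (α₀ + α₁))) ≤ 2 ∧
        2 * (B₁' * (α₀ + α₁)) ≤ c3 4 L ∧ ((4 : ℕ) : ℝ) * L * α₁ ≤ 1 / 8 ∧ α₀ ≤ cP' ∧ α₁ ≤ cP' ∧ B₁' * (α₀ + α₁) ≤ cP' ∧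
        2 * (B₁' * (α₀ + α₁)) ^ 2 + 20 * ((4 : ℕ) : ℝ) * α₀ * (B₁' * (α₀ + α₁)) + 2 * C₂ * (B₁' * (α₀ + α₁)) ^ 2 ≤ α₀ + α₁) ∧
      B8.Thm4Body c₁ B₁' (fun i : {i : ZdIdx 4 L // (∀ j, i.Ω j = Set.univ) ∧ (∀ m j, i.Λs m j = {_y | j = m}) ∧ (∀ m j, i.Λb m j = {_c | j = m}) ∧ i.η = ((L : ℝ)⁻¹) ^ i.k} => (zdGF3 𝔸 L β len i.1).toGFData) ∧
      B8.Prop3Body cP' 4 (L : ℝ) C₂ inp B₀β (fun i : {i : ZdIdx 4 L // (∀ j, i.Ω j = Set.univ) ∧ (∀ m j, i.Λs m j = {_y | j = m}) ∧ (∀ m j, i.Λb m j = {_c | j = m}) ∧ i.η = ((L : ℝ)⁻¹) ^ i.k} => (zdGF3 𝔸 L β len i.1).toGFData2) := by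
  have hL1 : 1 ≤ L := by omega
  -- §1: Proposition 3's b9 socket at every pinned member and every truncation (Theorem 3.3 opened once)
  obtain ⟨B₀, B₀β, cP, hB₀, hB₀β, hcP, SB9⟩ := sockB9P3_allLevels_allTorusPinned_of_thm33 hL β len geo bg GA h33 mem ιCfg ιLoc ops
    hdict hP6 hinv hcurv hlan havg hhol hc₆ hK₆ ha₃ hc69 hq
  -- the [B9] input pair of Proposition 3: `B₀` from Theorem 3.3, the free constant `B₀'` large enough for the letters route ((1.102)–(1.103) p. 93)
  obtain ⟨inp, hiB₀, hiB₀'⟩ : ∃ inp : B8.B9Inputs, inp.B₀ = B₀ ∧ inp.B₀' = max 1 (3 * (2 * ((4 : ℕ) : ℝ) * (L : ℝ) ^ 2) * BG * BR) :=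
    ⟨⟨B₀, max 1 (3 * (2 * ((4 : ℕ) : ℝ) * (L : ℝ) ^ 2) * BG * BR), by linarith, lt_of_lt_of_le one_pos (le_max_left _ _)⟩, rfl, rfl⟩
  have hLr : (2 : ℝ) ≤ L := by exact_mod_cast hL
  have hB : 2 ≤ 5 * ((4 : ℕ) : ℝ) * L * inp.B₀ := by
    rw [hiB₀]; push_cast; nlinarith [mul_le_mul hLr hB₀ zero_le_one (by linarith : (0 : ℝ) ≤ L)]
  have hfree : 3 * (2 * ((4 : ℕ) : ℝ) * (L : ℝ) ^ 2) * BG * BR ≤ inp.B₀' := by rw [hiB₀']; exact le_max_right _ _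
  have hC₂ : 2097152 * (((4 : ℕ) : ℝ) + 1) ^ 2 ≤ 2097152 * (((4 : ℕ) : ℝ) + 1) ^ 2 := le_rfl
  have SB9all : ∀ (i : {i : ZdIdx 4 L // (∀ j, i.Ω j = Set.univ) ∧ (∀ m j, i.Λs m j = {_y | j = m}) ∧ (∀ m j, i.Λb m j = {_c | j = m}) ∧ i.η = ((L : ℝ)⁻¹) ^ i.k}) (m : ℕ),
      m ≤ i.1.k → SockB9P3 (𝔸 := 𝔸) L inp.B₀ B₀β cP β len i.1.η m i.1.Ω i.1.Λs i.1.Λb := by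
    rw [hiB₀]; exact SB9
  -- n05-d's four printed statements over the index map `Subtype.val` (the pinned members' laws: towers trivial at `Ω ≡ univ`, №8 from F47's four-law certificate)
  obtain ⟨-, -, hP3, hT4⟩ := fourPrinted_zd3_map_lettersRDUB (𝔸 := 𝔸) (d := 4) (by norm_num) hL 0 β len inp hB hB₀β hC₂ hcP hB₀'H hB₂' hBG hBR hcL hfree
    (fun i : {i : ZdIdx 4 L // (∀ j, i.Ω j = Set.univ) ∧ (∀ m j, i.Λs m j = {_y | j = m}) ∧ (∀ m j, i.Λb m j = {_c | j = m}) ∧ i.η = ((L : ℝ)⁻¹) ^ i.k} => i.1)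
    (fun i => i.2.1 0)
    (fun i _ _ n _ _ _ x _ => Set.eq_univ_iff_forall.1 (i.2.1 n) x)
    (fun i => (idxB8LawsB_allTorusPinned hL1 i).toIdxB8Laws.trunc_lt)
    (fun i => (idxB8LawsB_allTorusPinned hL1 i).toIdxB8Laws.trunc_top)
    SLet SLetUB SB9all
  obtain ⟨c₁, hc₁, hT⟩ := hT4
  obtain ⟨cP', hcP', hP⟩ := hP3
  -- the letter `B₁' := 5·4·L·inp.B₀` and dag-n16-c's window below the two printed thresholds
  have hLpos : (0 : ℝ) < L := by linarith
  have hiBpos : 0 < inp.B₀ := inp.B₀_pos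
  have hB₁' : 0 < 5 * ((4 : ℕ) : ℝ) * L * inp.B₀ := by positivity
  obtain ⟨c₁', hc₁', hwin⟩ := exists_window_print (d := 4) (L := L) (by norm_num) hL (2097152 * (((4 : ℕ) : ℝ) + 1) ^ 2) hc₁ hcP' hB₁'
  exact ⟨c₁, c₁', 5 * ((4 : ℕ) : ℝ) * L * inp.B₀, cP', 2097152 * (((4 : ℕ) : ℝ) + 1) ^ 2, B₀β, inp, hB₁', le_rfl, hc₁', hwin, hT, hP⟩

end

end Summit.QuantumFields.YangMills.BalabanUVNodes.N16LeafLettersAllTorusOfThm33
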